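import Summits.QuantumFields.YangMills.Theorems.UnitScaleTiltProp7PinnedKernelSources
import HarnessLib

/-!
# Route `UnitScaleTilt`, crux K1 «MinimiserStabilityRegPr» (stmt-QuantumFields-19200), route-R E′ path (α′), residue (hK), assembly (A), brick (U):
# THE BUMP EXTENSION OF THE NEAR DATUM — `u := Σ_y a_y·β_y` over a family of bumps with PAIRWISE DISJOINT supports, `β_y(e_y) = 1`, `β_y(e_{y′}) = 0`:
# `u(e_y) = a_y`, `Σ|Δu| ≤ D₀·B_β·|T|`, `√Σ(ωΔu)² ≤ Ω·D₀·B_β·√|T|` — the numbers `N₃`, `N₄` and the row `hu` of ✓ `Prop7PinnedKernelL1OfRows.sum_abs_laplace_sub_interp_le_of_rows`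

Cell `ym3-torus`, width seat `ym3-torus-px22` (gen 2) = the (A)-instantiation seat (★routeR-w3 g5 19:59:56Z; bump caveat 19:59:56Z (i) answered 20:03Z: C¹ cutoff bumps
✓p660942 at scale `ℓ∕(10√d+4)`, disjoint supports); LOCATE 19200 evidence `LOCATE-A3-FARFIELD-px22g2.md` v1.2 §4.  `--supports stmt-QuantumFields-19200`, count-neutral.
THEOREMS ONLY (0 `def`, 0 `sorry`).  YM₃ on T³ is a ladder rung (R3), not the Clay problem; nothing here claims the stub, the crux, d = 4 or the gap.

THE POINT.  The near datum `a_y = (χ₀V)(e_y)` (nonzero on the O(1)·(R∕ℓ)^d centres inside `supp χ₀`) is extended by `u = Σ_y a_y β_y`; because the supports `S_y ∋ supp Δβ_y` are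
pairwise disjoint and all inside one set `T` (a site ball of radius `≍ ℓ`), `Δu` has AT MOST ONE nonzero term at each site: `|Δu| ≤ D₀B_β` on `T`, `0` off `T` — no count of centres
is needed, only `|T|` (✓ `card_torusBall_le` at the consumer).  Scale reading (d = 3): `B_β = 9dc²∕ℓ_β² ≍ ℓ⁻²`, `|T| ≍ ℓ³`, `D₀ ≍ 1` ⇒ `N₃ ≍ ℓ`, `N₄ ≍ ℓ^{−1∕2}`.

WHAT IS PROVED (ns `…Theorems.Prop7PinnedKernelBumps`; torus `T^{(j)}`, any `d`, `c`; a Fintype `Y` of centre labels, an injection-free statement: the centre map `e : Y → Site P j` enters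
only through `β_y(e_{y′}) = δ_{yy′}`).
* §1 `laplace_sum_mul_const` (`Δ(Σ_y a_y β_y) = Σ_y a_y Δβ_y`), `bump_ext_apply_centre` (`u(e_y) = a_y`),
  `abs_laplace_bump_ext_le` (`|Δu(z)| ≤ D₀B_β`, and `= 0` off `⋃_{y∈Y₀} S_y`).
* §2 ★★ `sum_abs_laplace_bump_ext_le` (`N₃ ≤ D₀·B_β·|T|`), ★★ `sqrt_sum_sq_weighted_laplace_bump_ext_le` (`N₄ ≤ Ω·D₀·B_β·√|T|`).
HONEST SCOPE.  Bookkeeping only; the bumps, their supports, `T` and the datum bound `D₀` ((R2) via (R5c)) are displayed.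

References: T. Bałaban, CMP 96 (1984) 223–250 [Balaban1984PropagatorsII] ((1.9) p.226); CMP 99 (1985) 75–102 [Balaban1985RegularSpaces] ((1.14) p.78, (1.36) p.82).
-/

set_option autoImplicit false

noncomputable section

open scoped BigOperators

namespace Summit.QuantumFields.YangMills.Theorems.Prop7PinnedKernelBumps

open Literature.MathematicalPhysics.QuantumFieldTheory.Balaban1983to89
open Finset LatticeFieldCalculus
open Summit.QuantumFields.YangMills.Theorems.Prop7PinnedKernelSources (sqrt_sum_sq_weighted_le_of_supported sum_abs_le_card_mul_of_supported)

variable {P : Params} {j : ℕ} {Y : Type*} [Fintype Y]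

/-! ## §1 The extension and its Laplacian, pointwise -/

/-- `Δ(Σ_y a_y β_y)(z) = Σ_y a_y (Δβ_y)(z)`. [cite: Balaban1984PropagatorsI, (1.21) p.21] -/
theorem laplace_sum_mul_const (c : ℝ) (a : Y → ℝ) (β : Y → SiteField P j ℝ) (z : Site P j) :
    laplace c (fun x => ∑ y, a y * β y x) z = ∑ y, a y * laplace c (β y) z := by
  simp only [laplace, smul_eq_mul, Finset.mul_sum, ← Finset.sum_sub_distrib, ← Finset.sum_add_distrib]
  rw [Finset.sum_comm]
  refine Finset.sum_congr rfl fun y _ => ?_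
  refine Finset.sum_congr rfl fun μ _ => ?_
  ring

/-- `u(e_y) = a_y` when `β_y(e_y) = 1` and `β_{y′}(e_y) = 0` for `y′ ≠ y`. [folklore] -/
theorem bump_ext_apply_centre (a : Y → ℝ) (β : Y → SiteField P j ℝ) (e : Y → Site P j)
    (hβ1 : ∀ y, β y (e y) = 1) (hβ0 : ∀ y y', y ≠ y' → β y (e y') = 0) (y : Y) :
    ∑ y', a y' * β y' (e y) = a y := by
  rw [Finset.sum_eq_single y]
  · rw [hβ1, mul_one]
  · intro y' _ hy'
    rw [hβ0 y' y hy', mul_zero]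
  · intro h; exact absurd (Finset.mem_univ y) h

/-- **POINTWISE**: if `a_y = 0` off `Y₀`, `|a_y| ≤ D₀`, `Δβ_y = 0` off `S_y`, `|Δβ_y| ≤ B_β`, and the `S_y` (`y ∈ Y₀`) are pairwise disjoint, then `|Δu(z)| ≤ D₀·B_β` everywhere and
`Δu(z) = 0` unless `z ∈ S_y` for some `y ∈ Y₀`. [cite: Balaban1985RegularSpaces, (1.14) p.78] -/
theorem abs_laplace_bump_ext_le (c : ℝ) (a : Y → ℝ) (β : Y → SiteField P j ℝ) (S : Y → Finset (Site P j)) (Y₀ : Finset Y) {D₀ Bβ : ℝ}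
    (hD₀ : 0 ≤ D₀) (hBβ : 0 ≤ Bβ)
    (ha0 : ∀ y ∉ Y₀, a y = 0) (haD : ∀ y, |a y| ≤ D₀)
    (hβS : ∀ y z, z ∉ S y → laplace c (β y) z = 0) (hβB : ∀ y z, |laplace c (β y) z| ≤ Bβ)
    (hdisj : ∀ y ∈ Y₀, ∀ y' ∈ Y₀, y ≠ y' → Disjoint (S y) (S y')) (z : Site P j) :
    |laplace c (fun x => ∑ y, a y * β y x) z| ≤ D₀ * Bβ
      ∧ ((∀ y ∈ Y₀, z ∉ S y) → laplace c (fun x => ∑ y, a y * β y x) z = 0) := by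
  classical
  rw [laplace_sum_mul_const]
  -- only `y ∈ Y₀` with `z ∈ S y` contribute
  have hvan : ∀ y, y ∉ Y₀.filter (fun y => z ∈ S y) → a y * laplace c (β y) z = 0 := by
    intro y hy
    rw [Finset.mem_filter, not_and] at hy
    by_cases hy0 : y ∈ Y₀
    · rw [hβS y z (hy hy0), mul_zero]
    · rw [ha0 y hy0, zero_mul]
  have hrestrict : ∑ y, a y * laplace c (β y) z = ∑ y ∈ Y₀.filter (fun y => z ∈ S y), a y * laplace c (β y) z := by
    rw [← Finset.sum_subset (Finset.subset_univ _)]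
    intro y _ hy
    exact hvan y hy
  refine ⟨?_, fun hz => ?_⟩
  · rw [hrestrict]
    calc |∑ y ∈ Y₀.filter (fun y => z ∈ S y), a y * laplace c (β y) z|
        ≤ ∑ y ∈ Y₀.filter (fun y => z ∈ S y), |a y * laplace c (β y) z| := Finset.abs_sum_le_sum_abs _ _
      _ ≤ ∑ _y ∈ Y₀.filter (fun y => z ∈ S y), D₀ * Bβ := Finset.sum_le_sum fun y _ => by
          rw [abs_mul]; exact mul_le_mul (haD y) (hβB y z) (abs_nonneg _) hD₀
      _ = (Y₀.filter (fun y => z ∈ S y)).card * (D₀ * Bβ) := by rw [Finset.sum_const, nsmul_eq_mul]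
      _ ≤ 1 * (D₀ * Bβ) := by
          refine mul_le_mul_of_nonneg_right ?_ (by positivity)
          -- pairwise disjoint supports: `z` lies in at most one `S y`
          have hle : (Y₀.filter (fun y => z ∈ S y)).card ≤ 1 := by
            rw [Finset.card_le_one]
            intro y hy y' hy'
            rw [Finset.mem_filter] at hy hy'
            by_contra h
            exact Finset.disjoint_left.mp (hdisj y hy.1 y' hy'.1 h) hy.2 hy'.2
          exact_mod_cast hle
      _ = D₀ * Bβ := one_mul _
  · rw [hrestrict]
    have hempty : Y₀.filter (fun y => z ∈ S y) = ∅ := by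
      rw [Finset.filter_eq_empty_iff]
      intro y hy
      exact hz y hy
    rw [hempty, Finset.sum_empty]

/-! ## §2 ★★ The numbers `N₃`, `N₄` -/

/-- ★★ **`N₃`**: `Σ_z|Δu(z)| ≤ |T|·(D₀·B_β)` when all supports `S_y` (`y ∈ Y₀`) lie in `T`. [cite: Balaban1985RegularSpaces, (1.36) p.82] -/
theorem sum_abs_laplace_bump_ext_le (c : ℝ) (a : Y → ℝ) (β : Y → SiteField P j ℝ) (S : Y → Finset (Site P j)) (Y₀ : Finset Y) (T : Finset (Site P j))
    {D₀ Bβ : ℝ} (hD₀ : 0 ≤ D₀) (hBβ : 0 ≤ Bβ)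
    (ha0 : ∀ y ∉ Y₀, a y = 0) (haD : ∀ y, |a y| ≤ D₀)
    (hβS : ∀ y z, z ∉ S y → laplace c (β y) z = 0) (hβB : ∀ y z, |laplace c (β y) z| ≤ Bβ)
    (hdisj : ∀ y ∈ Y₀, ∀ y' ∈ Y₀, y ≠ y' → Disjoint (S y) (S y')) (hST : ∀ y ∈ Y₀, S y ⊆ T) :
    ∑ z, |laplace c (fun x => ∑ y, a y * β y x) z| ≤ T.card * (D₀ * Bβ) := by
  refine sum_abs_le_card_mul_of_supported T _ (fun z _ => (abs_laplace_bump_ext_le c a β S Y₀ hD₀ hBβ ha0 haD hβS hβB hdisj z).1)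
    (fun z hz => (abs_laplace_bump_ext_le c a β S Y₀ hD₀ hBβ ha0 haD hβS hβB hdisj z).2 fun y hy hzS => hz (hST y hy hzS))

/-- ★★ **`N₄`**: `√Σ_z(ω(z)·Δu(z))² ≤ Ω·(D₀·B_β)·√|T|` when all supports lie in `T` and `0 ≤ ω ≤ Ω` on `T`. [cite: Balaban1984PropagatorsII, (1.9) p.226] -/
theorem sqrt_sum_sq_weighted_laplace_bump_ext_le (c : ℝ) (a : Y → ℝ) (β : Y → SiteField P j ℝ) (S : Y → Finset (Site P j)) (Y₀ : Finset Y)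
    (T : Finset (Site P j)) (ω : SiteField P j ℝ) {D₀ Bβ Ω : ℝ} (hD₀ : 0 ≤ D₀) (hBβ : 0 ≤ Bβ) (hΩ0 : 0 ≤ Ω)
    (ha0 : ∀ y ∉ Y₀, a y = 0) (haD : ∀ y, |a y| ≤ D₀)
    (hβS : ∀ y z, z ∉ S y → laplace c (β y) z = 0) (hβB : ∀ y z, |laplace c (β y) z| ≤ Bβ)
    (hdisj : ∀ y ∈ Y₀, ∀ y' ∈ Y₀, y ≠ y' → Disjoint (S y) (S y')) (hST : ∀ y ∈ Y₀, S y ⊆ T)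
    (hω0 : ∀ z, 0 ≤ ω z) (hωT : ∀ z ∈ T, ω z ≤ Ω) :
    Real.sqrt (∑ z, (ω z * laplace c (fun x => ∑ y, a y * β y x) z) ^ 2) ≤ Ω * (D₀ * Bβ) * Real.sqrt T.card := by
  refine sqrt_sum_sq_weighted_le_of_supported T ω _ (by positivity) hΩ0 hω0 hωT
    (fun z _ => (abs_laplace_bump_ext_le c a β S Y₀ hD₀ hBβ ha0 haD hβS hβB hdisj z).1)
    (fun z hz => (abs_laplace_bump_ext_le c a β S Y₀ hD₀ hBβ ha0 haD hβS hβB hdisj z).2 fun y hy hzS => hz (hST y hy hzS))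

end Summit.QuantumFields.YangMills.Theorems.Prop7PinnedKernelBumps

end
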